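import Summits.PneNP.PneNP.Theorems.ChebyshevTracialDesignLevelWeightCompl
import HarnessLib

/-!
# Cell pnp-psdrank, route `ChebyshevTracialDesign`, brick 69: the MASS form of spectral non-tightness —
# a dense family of cuts and a homogeneous-dense set of matchings carry at least `29/60` of their share of tight pairs

Bricks 28/29 (`…SpectralNonTightness{,Wide}`) prove SNT in EXISTENCE form (some tight pair exists) by contradiction from the normalised
tightness identity. The same identity WITHOUT the tight-freeness assumption (`…TightFreeLayers.tight_pairs_eq_sum_layerCorr`:
`#tight(X×Y) = T_0 + Σ_{j≥1} T_j`, `T_0 = μ(X)·N_1·|Y|`, odd layers vanish) together with the head (Keevash–Lifshitz + slice level-`k`,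
`Σ_{κ ≤ dq n+8} |T_{2κ}| ≤ (4/15)·μν·|PM_n|N_1`) and tail (`≤ μν/4·|PM_n|N_1`) estimates of brick 28 gives the QUANTITATIVE form asked for in
MEMO-14 §5 (d)(3) / MEMO-15 §1 (the «jumbledness» input for density/DRC arguments in the tight graph):
* §1 `tight_card_ge_wide_of_globalLevelD` — for `2t ≤ n ≤ 5t`, `X` a family of `t`-subsets of density `μ ≥ exp(−c₀ dq n)`, `Y` a
  `(PM_n, τ)`-homogeneous set of perfect matchings of density `ν ≥ exp(−c₀ dq n)`:
  `#{(U,M) ∈ X × Y : |δ(U) ∩ M| = 1} ≥ (29/60)·μ·ν·|PM_n|·N_1` (`N_1 = C(n/2, c'+1)·(c'+1)·2` tight `t`-cuts per matching, `t = 2c'+1`).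
* §2 `tight_card_ge_sym_oddSet_of_globalLevelD` — the route's currency (`X : Finset (OddSet n)`, `cc`, `Qset n t 1`), balanced both ways
  (`n ≤ 5t`, `n ≤ 5(n−t)`, no `2t ≤ n`; complements as in brick 29): `#{(U,M) ∈ X × Y : cc U M = 1} ≥ (29/60)·μ·ν·|Q_1(t)|`.
[cite: KeevashLifshitz2023, Thm. 1.8] [cite: KupavskiiZakharov2022, §2] [cite: Rothvoss2017, §2 (PDF p. 6)] [cite: BrouwerHaemers2012, Prop. 4.3.2 (PDF p. 83)]
Stature: support/instrument (kernel theorems, no defs; conditional on `GlobalLevelDInequality` like bricks 28/29).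
WHAT THIS IS NOT: no upper bound (the symmetric `≤ 91/60` holds by the same estimates but is not needed), nothing on psd rank of `P_PM(K_n)`,
no P-vs-NP content. Supports stmt-PneNP-19878.
-/

set_option linter.dupNamespace false -- `Summit.PneNP.PneNP.…`: summit = sub-problem (D-0017)

noncomputable section

namespace Summit.PneNP.PneNP.Theorems.ChebyshevTracialDesignTightMass

open Finset Literature.Barriers.PneNP Literature.Combinatorics.Optimization
open Literature.Combinatorics.AssociationSchemes Literature.Combinatorics.AssociationSchemes.JohnsonHarmonics
open Literature.Combinatorics.AssociationSchemes.JohnsonSpectrum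
open Literature.Combinatorics.AssociationSchemes.HomogeneousMatchingFamilies
open Literature.Combinatorics.AssociationSchemes.SliceLevelInequality
open Literature.Combinatorics.SetFamily
open Literature.Combinatorics.SimpleGraph.CycleSpace
open Literature.Combinatorics.Additive.KeevashLifshitz
open Summit.PneNP.PneNP.Theorems.ChebyshevTracialDesignTightFreeSpectral
open Summit.PneNP.PneNP.Theorems.ChebyshevTracialDesignTightColumnSums
open Summit.PneNP.PneNP.Theorems.ChebyshevTracialDesignTightFreeLayers
open Summit.PneNP.PneNP.Theorems.ChebyshevTracialDesignTightLayerBimode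
open Summit.PneNP.PneNP.Theorems.ChebyshevTracialDesignLevelTail
open Summit.PneNP.PneNP.Theorems.ChebyshevTracialDesignLevelNormalisation
open Summit.PneNP.PneNP.Theorems.ChebyshevTracialDesignProfilePolynomial
open Summit.PneNP.PneNP.Theorems.ChebyshevTracialDesignProfileExtrapolation
open Summit.PneNP.PneNP.Theorems.ChebyshevTracialDesignSpectralNonTightnessLayers
open Summit.PneNP.PneNP.Theorems.ChebyshevTracialDesignSpectralNonTightnessEstimates
open Summit.PneNP.PneNP.Theorems.ChebyshevTracialDesignSpectralNonTightness
open Summit.PneNP.PneNP.Theorems.ChebyshevTracialDesignSpectralNonTightnessWide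
open Summit.PneNP.PneNP.Theorems.ChebyshevTracialDesignLevelWeightCompl

variable {n : ℕ}

/-! ### §1 The tight count of a rectangle through the layers -/

/-- **The tight count through the layers** (no tight-freeness assumed): for `t = 2c'+1 ≤ n`, a family `X` of `t`-subsets with harmonic layer
decomposition `p` of its indicator and any set `Y` of perfect matchings,
`#{(U,M) ∈ X × Y : |δ(U) ∩ M| = 1} = (|X|/C(n,t))·N_1·|Y| + Σ_{κ=1}^{c'} T_{2κ}(X,Y)` (the odd layers vanish).
[cite: Rothvoss2017, §2 (PDF p. 6)] [cite: BrouwerHaemers2012, Prop. 4.3.2 (PDF p. 83)] -/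
theorem tight_card_eq_layers {c' : ℕ} (ht : 2 * c' + 1 ≤ n) (X : Finset (Finset (Fin n)))
    (hX : X ⊆ univ.powersetCard (2 * c' + 1)) (Y : Finset (PMatch n)) (p : ℕ → Finset (Fin n) → ℝ) (hp : ∀ j, IsHarmonic j (p j))
    (hdec : ∀ U ∈ univ.powersetCard (2 * c' + 1),
      (if U ∈ X then (1 : ℝ) else 0) = (∑ j ∈ range (2 * c' + 1 + 1), up^[2 * c' + 1 - j] (p j)) U) :
    ((((X ×ˢ Y).filter fun UM : Finset (Fin n) × PMatch n =>
        (UM.1.filter fun x => UM.2.2.partner x ∉ UM.1).card = 1).card : ℕ) : ℝ) =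
      (X.card : ℝ) / (n.choose (2 * c' + 1) : ℝ) * ((((n / 2).choose (1 + c') * (1 + c').choose c' * 2 ^ 1 : ℕ) : ℝ) * Y.card) +
      ∑ κ ∈ Icc 1 c', ∑ M ∈ Y, ∑ U ∈ univ.powersetCard (2 * c' + 1),
        (up^[2 * c' + 1 - 2 * κ] (p (2 * κ))) U * (if (U.filter fun x => M.2.partner x ∉ U).card = 1 then (1 : ℝ) else 0) := by
  classical
  have htot := tight_pairs_eq_sum_layerCorr X hX Y p hdec
  rw [range_eq_Ico, ← Finset.sum_Ico_consecutive _ (Nat.zero_le 1) (by omega : 1 ≤ 2 * c' + 1 + 1),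
    show Ico 0 1 = {0} by rfl, sum_singleton, layerCorr_zero_eq ht X hX Y p hp hdec] at htot
  rw [htot, add_right_inj]
  -- remove the odd layers and reindex the even ones
  rw [← sum_filter_add_sum_filter_not (Ico 1 (2 * c' + 1 + 1)) (fun j => Even j), filter_even_Ico_eq_map c', sum_map]
  have hodd : ∑ j ∈ (Ico 1 (2 * c' + 1 + 1)).filter (fun j => ¬Even j), ∑ M ∈ Y, ∑ U ∈ univ.powersetCard (2 * c' + 1),
      (up^[2 * c' + 1 - j] (p j)) U * (if (U.filter fun x => M.2.partner x ∉ U).card = 1 then (1 : ℝ) else 0) = 0 := by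
    refine sum_eq_zero fun j hj => ?_
    obtain ⟨hj1, hj2⟩ := mem_filter.1 hj
    exact layerCorr_eq_zero_of_odd ⟨c', rfl⟩ (Nat.not_even_iff_odd.1 hj2) (by have := (mem_Ico.1 hj1).2; omega) Y (hp j)
  rw [hodd, add_zero]
  rfl

/-! ### §2 The mass form of spectral non-tightness on wide balanced slices -/

/-- **SPECTRAL NON-TIGHTNESS, MASS FORM (mod Keevash–Lifshitz Thm 1.8).** Assume `GlobalLevelDInequality`. For every `τ ≥ 1` there are
`c₀ > 0` and `n₁` such that: for all even `n ≥ n₁`, all `t = 2c'+1` with `2t ≤ n ≤ 5t`, every family `X` of `t`-subsets of `Fin n` with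
`μ = |X|/C(n,t) ≥ exp(−c₀·dq n)` and every set `Y` of perfect matchings of `K_n` whose edge sets are `(PM_n, τ)`-homogeneous with
`ν = |Y|/|PM_n| ≥ exp(−c₀·dq n)`, the number of TIGHT pairs is at least `29/60` of its share:
`#{(U,M) ∈ X × Y : |δ(U) ∩ M| = 1} ≥ (29/60)·μ·ν·|PM_n|·N_1`, `N_1 = C(n/2, c'+1)·(c'+1)·2` (so `|PM_n|·N_1 = |Q_1(t)|`). Proof: the layer
identity of §1 with brick 28's head (`≤ 4μν/15`) and tail (`≤ μν/4`) estimates. [cite: KeevashLifshitz2023, Thm. 1.8]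
[cite: KupavskiiZakharov2022, §2] [cite: Rothvoss2017, §2 (PDF p. 6)] [cite: ODonnell2014, §9.5] -/
theorem tight_card_ge_wide_of_globalLevelD (hKL : GlobalLevelDInequality) {τ : ℝ} (hτ : 1 ≤ τ) :
    ∃ c₀ : ℝ, 0 < c₀ ∧ ∃ n₁ : ℕ, ∀ (n c' : ℕ), n₁ ≤ n → Even n → 2 * (2 * c' + 1) ≤ n → n ≤ 5 * (2 * c' + 1) →
      ∀ (X : Finset (Finset (Fin n))), X ⊆ univ.powersetCard (2 * c' + 1) →
      ∀ (Y : Finset (PMatch n)), IsRelHomogeneous τ (perfectMatchings (univ : Finset (Fin n))) (Y.image Subtype.val) →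
      Real.exp (-(c₀ * dq n)) ≤ (X.card : ℝ) / (n.choose (2 * c' + 1) : ℝ) →
      Real.exp (-(c₀ * dq n)) ≤ (Y.card : ℝ) / (Fintype.card (PMatch n) : ℝ) →
      (29 / 60 : ℝ) * ((X.card : ℝ) / (n.choose (2 * c' + 1) : ℝ)) * ((Y.card : ℝ) / (Fintype.card (PMatch n) : ℝ)) *
          ((Fintype.card (PMatch n) : ℝ) * ((((n / 2).choose (1 + c') * (1 + c').choose c' * 2 ^ 1 : ℕ) : ℝ))) ≤
        ((((X ×ˢ Y).filter fun UM : Finset (Fin n) × PMatch n =>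
          (UM.1.filter fun x => UM.2.2.partner x ∉ UM.1).card = 1).card : ℕ) : ℝ) := by
  obtain ⟨C, hC, hKLb⟩ := abs_layerCorr_even_le_KL hKL
  have hτ0 : 0 < τ := one_pos.trans_le hτ
  have hc₁pos : 0 < 1 / (2736 * C * τ ^ 2) := by positivity
  refine ⟨min 1 (1 / (2736 * C * τ ^ 2)), lt_min one_pos hc₁pos, (2 * 10 ^ 8) ^ 4, ?_⟩
  intro n c' hn₁ hn ht hbal X hX Y hhom hμ hν
  have hc₀0 : 0 < min 1 (1 / (2736 * C * τ ^ 2)) := lt_min one_pos hc₁pos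
  have hc₀1 : min 1 (1 / (2736 * C * τ ^ 2)) ≤ 1 := min_le_left _ _
  have hc₀C : min 1 (1 / (2736 * C * τ ^ 2)) ≤ 1 / (2736 * C * τ ^ 2) := min_le_right _ _
  -- the size parameter `D = dq n ≥ 2·10⁸`, `D⁴ ≤ n`
  have hD : 2 * 10 ^ 8 ≤ dq n := by
    unfold dq
    rw [Nat.le_sqrt, Nat.le_sqrt]
    calc 2 * 10 ^ 8 * (2 * 10 ^ 8) * (2 * 10 ^ 8 * (2 * 10 ^ 8)) = (2 * 10 ^ 8) ^ 4 := by norm_num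
      _ ≤ n := hn₁
  have hD4n : dq n ^ 4 ≤ n := by
    have h1 : dq n * dq n ≤ Nat.sqrt n := Nat.sqrt_le (Nat.sqrt n)
    calc dq n ^ 4 = (dq n * dq n) * (dq n * dq n) := by ring
      _ ≤ Nat.sqrt n * Nat.sqrt n := Nat.mul_le_mul h1 h1
      _ ≤ n := Nat.sqrt_le n
  have hD2 : dq n * dq n ≤ dq n ^ 4 := by
    calc dq n * dq n = dq n * dq n * 1 := (mul_one _).symm
      _ ≤ dq n * dq n * (dq n * dq n) := Nat.mul_le_mul_left _ (Nat.one_le_iff_ne_zero.2 (by positivity))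
      _ = dq n ^ 4 := by ring
  have h100 : 100 ≤ n := by
    have : 100 ≤ dq n * dq n := by nlinarith
    omega
  have h32 : 32 * (dq n + 8) ≤ n := by
    have : 32 * (dq n + 8) ≤ dq n * dq n := by nlinarith
    omega
  -- the harmonic layer decomposition of `1_X` and the Gram class function of the tight incidence
  have hhomog : IsHomog (2 * c' + 1) (fun U : Finset (Fin n) => if U ∈ X then (1 : ℝ) else 0) := by
    intro S hS
    simp only
    rw [if_neg]
    intro hSX
    exact hS (mem_powersetCard.1 (hX hSX)).2
  obtain ⟨p, hp, hpeq⟩ := exists_ladder_decomposition (by omega : 2 * (2 * c' + 1) ≤ n + 1) hhomog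
  have hdec : ∀ U ∈ univ.powersetCard (2 * c' + 1),
      (if U ∈ X then (1 : ℝ) else 0) = (∑ j ∈ range (2 * c' + 1 + 1), up^[2 * c' + 1 - j] (p j)) U :=
    fun U _ => congrFun hpeq U
  obtain ⟨κ₁, hA1⟩ := exists_tightGram_classFunction (n := n) (t := 2 * c' + 1) ⟨c', rfl⟩
  -- densities
  have hPMpos : (0 : ℝ) < Fintype.card (PMatch n) := by exact_mod_cast card_pmatch_pos hn
  have hCnpos : (0 : ℝ) < (n.choose (2 * c' + 1) : ℝ) := by exact_mod_cast Nat.choose_pos (by omega)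
  have hN1pos : (0 : ℝ) < ((((n / 2).choose (1 + c') * (1 + c').choose c' * 2 ^ 1 : ℕ) : ℝ)) := by
    have h1 : 0 < (n / 2).choose (1 + c') := Nat.choose_pos (by omega)
    have h2 : 0 < (1 + c').choose c' := Nat.choose_pos (by omega)
    positivity
  have hμ1 : (X.card : ℝ) / (n.choose (2 * c' + 1) : ℝ) ≤ 1 := by
    rw [div_le_one hCnpos]
    have := card_le_card hX
    rw [card_powersetCard, card_univ, Fintype.card_fin] at this
    exact_mod_cast this
  have hν1 : (Y.card : ℝ) / (Fintype.card (PMatch n) : ℝ) ≤ 1 := by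
    rw [div_le_one hPMpos]
    exact_mod_cast (card_le_univ Y).trans_eq Finset.card_univ
  -- the layer identity
  have hid := tight_card_eq_layers (by omega) X hX Y p hp hdec
  set PM : ℝ := (Fintype.card (PMatch n) : ℝ) with hPM
  set N1 : ℝ := ((((n / 2).choose (1 + c') * (1 + c').choose c' * 2 ^ 1 : ℕ) : ℝ)) with hN1
  set μ : ℝ := (X.card : ℝ) / (n.choose (2 * c' + 1) : ℝ) with hμdef
  set ν : ℝ := (Y.card : ℝ) / (Fintype.card (PMatch n) : ℝ) with hνdef
  -- the even layers: |T_{2κ}|/(PM·N1), head and tail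
  have hbound : ∑ κ ∈ Icc 1 c', |∑ M ∈ Y, ∑ U ∈ univ.powersetCard (2 * c' + 1),
      (up^[2 * c' + 1 - 2 * κ] (p (2 * κ))) U * (if (U.filter fun x => M.2.partner x ∉ U).card = 1 then (1 : ℝ) else 0)| /
      (PM * N1) ≤ 4 * μ * ν * (1 / 15) + μ * ν / 4 := by
    rw [← sum_filter_add_sum_filter_not (Icc 1 c') (fun κ => κ ≤ dq n + 8)]
    refine add_le_add ?_ ?_
    · -- HEAD
      have hhead : ∀ κ ∈ (Icc 1 c').filter (fun κ => κ ≤ dq n + 8),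
          |∑ M ∈ Y, ∑ U ∈ univ.powersetCard (2 * c' + 1),
              (up^[2 * c' + 1 - 2 * κ] (p (2 * κ))) U * (if (U.filter fun x => M.2.partner x ∉ U).card = 1 then (1 : ℝ) else 0)| /
              (PM * N1) ≤ 4 * μ * ν * (1 / 16) ^ κ := by
        intro κ hκ
        obtain ⟨hκI, hκD⟩ := mem_filter.1 hκ
        obtain ⟨hκ1, hκc⟩ := mem_Icc.1 hκI
        have h4κn : 4 * κ ≤ n := by omega
        have h32κn : 16 * (2 * κ) ≤ n := by omega
        have hL := ladder_ip_le_level' (t := 2 * c' + 1) (j := 2 * κ) h100 hbal (by omega) (by omega) h32κn X hX p hp hdec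
        have hLq : ip (up^[2 * c' + 1 - 2 * κ] (p (2 * κ))) (up^[2 * c' + 1 - 2 * κ] (p (2 * κ))) / (n.choose (2 * c' + 1) : ℝ) ≤
            16 * μ ^ 2 * (48 * (Real.exp 1 * (2 * Real.log (1 / μ) / ((2 * κ : ℕ) : ℝ) + 3))) ^ (2 * κ) := by
          rw [div_le_iff₀ hCnpos]
          calc ip (up^[2 * c' + 1 - 2 * κ] (p (2 * κ))) (up^[2 * c' + 1 - 2 * κ] (p (2 * κ)))
              ≤ 16 * (n.choose (2 * c' + 1) : ℝ) * μ ^ 2 * (48 * (Real.exp 1 * (2 * Real.log (1 / μ) / ((2 * κ : ℕ) : ℝ) + 3))) ^ (2 * κ) := hL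
            _ = 16 * μ ^ 2 * (48 * (Real.exp 1 * (2 * Real.log (1 / μ) / ((2 * κ : ℕ) : ℝ) + 3))) ^ (2 * κ) *
                (n.choose (2 * c' + 1) : ℝ) := by ring
        exact head_term_abstract hC hτ hc₀0 hc₀1 hc₀C hD hD4n hκ1 hκD (mul_pos hPMpos hN1pos) (atten_le_pow h4κn)
          (div_nonneg (ip_self_nonneg _) hCnpos.le) hLq hμ hμ1 hν hν1
          (fun h8 h5 => hKLb n c' κ hn ht hκ1 hκc Y τ hτ hhom h8 h5 p hp κ₁ hA1)
          (abs_layerCorr_even_le_parseval hn ht hκc Y p hp κ₁ hA1)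
      refine (sum_le_sum hhead).trans ?_
      rw [← mul_sum]
      refine mul_le_mul_of_nonneg_left ?_ (by positivity)
      have hsub : (Icc 1 c').filter (fun κ => κ ≤ dq n + 8) ⊆ Ico 1 (dq n + 9) := by
        intro κ hκ
        obtain ⟨hκI, hκD⟩ := mem_filter.1 hκ
        rw [mem_Ico]; have := (mem_Icc.1 hκI).1; omega
      calc ∑ κ ∈ (Icc 1 c').filter (fun κ => κ ≤ dq n + 8), ((1 : ℝ) / 16) ^ κ
          ≤ ∑ κ ∈ Ico 1 (dq n + 9), ((1 : ℝ) / 16) ^ κ :=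
            sum_le_sum_of_subset_of_nonneg hsub fun κ _ _ => by positivity
        _ ≤ ((1 : ℝ) / 16) ^ 1 / (1 - 1 / 16) := geom_sum_Ico_le_of_lt_one (by norm_num) (by norm_num)
        _ = 1 / 15 := by norm_num
    · -- TAIL
      have htail : ∀ κ ∈ (Icc 1 c').filter (fun κ => ¬κ ≤ dq n + 8),
          |∑ M ∈ Y, ∑ U ∈ univ.powersetCard (2 * c' + 1),
              (up^[2 * c' + 1 - 2 * κ] (p (2 * κ))) U * (if (U.filter fun x => M.2.partner x ∉ U).card = 1 then (1 : ℝ) else 0)| /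
              (PM * N1) ≤ Real.sqrt (μ * ν * ∏ i ∈ range (dq n + 9), ((2 * i + 1 : ℝ) / ((n : ℝ) - 2 * i))) := by
        intro κ hκ
        obtain ⟨hκI, hκD⟩ := mem_filter.1 hκ
        obtain ⟨hκ1, hκc⟩ := mem_Icc.1 hκI
        exact tail_term_le hn ht hκc (by omega) X hX Y p hp hdec κ₁ hA1
      refine (sum_le_sum htail).trans ?_
      rw [sum_const, nsmul_eq_mul]
      have hcard : (((Icc 1 c').filter (fun κ => ¬κ ≤ dq n + 8)).card : ℝ) ≤ c' := by
        have h := card_filter_le (Icc 1 c') (fun κ => ¬κ ≤ dq n + 8)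
        rw [Nat.card_Icc] at h
        exact_mod_cast (h.trans (by omega))
      calc (((Icc 1 c').filter (fun κ => ¬κ ≤ dq n + 8)).card : ℝ) *
            Real.sqrt (μ * ν * ∏ i ∈ range (dq n + 9), ((2 * i + 1 : ℝ) / ((n : ℝ) - 2 * i)))
          ≤ (c' : ℝ) * Real.sqrt (μ * ν * ∏ i ∈ range (dq n + 9), ((2 * i + 1 : ℝ) / ((n : ℝ) - 2 * i))) :=
            mul_le_mul_of_nonneg_right hcard (Real.sqrt_nonneg _)
        _ ≤ _ := tail_sum_arith (by omega) ht hc₀1 hμ hν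
  -- assemble: #tight = μ N1 |Y| + S ≥ μ N1 |Y| − Σ|T_{2κ}| ≥ (29/60) μ ν PM N1
  have hPN : 0 < PM * N1 := mul_pos hPMpos hN1pos
  have hS : -(∑ κ ∈ Icc 1 c', ∑ M ∈ Y, ∑ U ∈ univ.powersetCard (2 * c' + 1),
        (up^[2 * c' + 1 - 2 * κ] (p (2 * κ))) U * (if (U.filter fun x => M.2.partner x ∉ U).card = 1 then (1 : ℝ) else 0)) ≤
      (4 * μ * ν * (1 / 15) + μ * ν / 4) * (PM * N1) := by
    have h1 := (neg_le_abs (∑ κ ∈ Icc 1 c', ∑ M ∈ Y, ∑ U ∈ univ.powersetCard (2 * c' + 1),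
        (up^[2 * c' + 1 - 2 * κ] (p (2 * κ))) U * (if (U.filter fun x => M.2.partner x ∉ U).card = 1 then (1 : ℝ) else 0))).trans
      (abs_sum_le_sum_abs _ _)
    have h2 : ∑ κ ∈ Icc 1 c', |∑ M ∈ Y, ∑ U ∈ univ.powersetCard (2 * c' + 1),
        (up^[2 * c' + 1 - 2 * κ] (p (2 * κ))) U * (if (U.filter fun x => M.2.partner x ∉ U).card = 1 then (1 : ℝ) else 0)| =
        (∑ κ ∈ Icc 1 c', |∑ M ∈ Y, ∑ U ∈ univ.powersetCard (2 * c' + 1),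
          (up^[2 * c' + 1 - 2 * κ] (p (2 * κ))) U * (if (U.filter fun x => M.2.partner x ∉ U).card = 1 then (1 : ℝ) else 0)| /
          (PM * N1)) * (PM * N1) := by
      rw [← sum_div, div_mul_cancel₀ _ hPN.ne']
    rw [h2] at h1
    exact h1.trans (mul_le_mul_of_nonneg_right hbound hPN.le)
  have hY : (Y.card : ℝ) = ν * PM := by
    rw [hνdef, hPM, div_mul_cancel₀ _ hPMpos.ne']
  rw [hid, hY]
  have hμν : 0 ≤ μ * ν := mul_nonneg ((Real.exp_pos _).le.trans hμ) ((Real.exp_pos _).le.trans hν)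
  nlinarith

/-! ### §3 Complement symmetry: the route's currency -/

/-- **SNT mass form in the route's currency.** Under `GlobalLevelDInequality`, for every `τ ≥ 1` there are `c₀ > 0`, `n₁` such that for even
`n ≥ n₁`, odd `t` with `n ≤ 5t` and `n ≤ 5(n−t)` (no `2t ≤ n` needed: pass to complements, `cc` and `|Q_1|` are complement-invariant),
`X : Finset (OddSet n)` a family of `t`-cuts with `|X|/C(n,t) ≥ exp(−c₀ dq n)` and `Y` a `(PM_n, τ)`-homogeneous set of perfect matchings with
`|Y|/|PM_n| ≥ exp(−c₀ dq n)`:  `#{(U,M) ∈ X × Y : cc U M = 1} ≥ (29/60)·(|X|/C(n,t))·(|Y|/|PM_n|)·|Q_1(t)|`.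
[cite: KeevashLifshitz2023, Thm. 1.8] [cite: KupavskiiZakharov2022, §2] [cite: Rothvoss2017, §2 (PDF p. 6)] -/
theorem tight_card_ge_sym_oddSet_of_globalLevelD (hKL : GlobalLevelDInequality) {τ : ℝ} (hτ : 1 ≤ τ) :
    ∃ c₀ : ℝ, 0 < c₀ ∧ ∃ n₁ : ℕ, ∀ (n t : ℕ), n₁ ≤ n → Even n → Odd t → n ≤ 5 * t → n ≤ 5 * (n - t) →
      ∀ (X : Finset (OddSet n)), (∀ U ∈ X, U.1.card = t) →
      ∀ (Y : Finset (PMatch n)), IsRelHomogeneous τ (perfectMatchings (univ : Finset (Fin n))) (Y.image Subtype.val) →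
      Real.exp (-(c₀ * dq n)) ≤ (X.card : ℝ) / (n.choose t : ℝ) →
      Real.exp (-(c₀ * dq n)) ≤ (Y.card : ℝ) / (Fintype.card (PMatch n) : ℝ) →
      (29 / 60 : ℝ) * ((X.card : ℝ) / (n.choose t : ℝ)) * ((Y.card : ℝ) / (Fintype.card (PMatch n) : ℝ)) * ((Qset n t 1).card : ℝ) ≤
        ((((X ×ˢ Y).filter fun UM : OddSet n × PMatch n => cc UM.1 UM.2 = 1).card : ℕ) : ℝ) := by
  classical
  obtain ⟨c₀, hc₀, n₁, h⟩ := tight_card_ge_wide_of_globalLevelD hKL hτ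
  refine ⟨c₀, hc₀, n₁, fun n t hn₁ hn hto h5 h5' X hXt Y hhom hμ hν => ?_⟩
  -- `X` is nonempty, so `t ≤ n`
  have hXne : X.Nonempty := by
    rw [nonempty_iff_ne_empty]
    rintro rfl
    have := (Real.exp_pos (-(c₀ * dq n))).trans_le hμ
    simp at this
  obtain ⟨U₀, hU₀⟩ := hXne
  have htn : t ≤ n := by
    have := card_le_univ U₀.1
    rw [Fintype.card_fin, hXt U₀ hU₀] at this
    exact this
  obtain ⟨c', rfl⟩ := hto
  -- `|Q_1(2c'+1)| = |PM|·N_1(c')`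
  have hQ : ((Qset n (2 * c' + 1) 1).card : ℝ) =
      (Fintype.card (PMatch n) : ℝ) * ((((n / 2).choose (1 + c') * (1 + c').choose c' * 2 ^ 1 : ℕ) : ℝ)) := by
    have h0 := card_Qset_eq (n := n) (c' := c') (m := 0) (Nat.zero_le _)
    simp only [Nat.mul_zero, Nat.zero_add, Nat.sub_zero] at h0
    rw [h0]
  by_cases h2t : 2 * (2 * c' + 1) ≤ n
  · -- the direct case
    have hX' : X.image Subtype.val ⊆ univ.powersetCard (2 * c' + 1) := by
      intro U hU
      obtain ⟨U', hU', rfl⟩ := mem_image.1 hU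
      exact mem_powersetCard_univ.2 (hXt U' hU')
    have hcard : ((X.image Subtype.val).card : ℝ) = X.card := by
      rw [card_image_of_injective _ Subtype.val_injective]
    have hmain := h n c' hn₁ hn h2t h5 (X.image Subtype.val) hX' Y hhom (by rw [hcard]; exact hμ) hν
    rw [hcard, ← hQ] at hmain
    refine hmain.trans (le_of_eq ?_)
    norm_cast
    refine card_bij (fun UM _ => (⟨UM.1, ?_⟩, UM.2)) (fun UM hUM => ?_) (fun UM _ UM' _ hh => ?_) (fun UM hUM => ?_)
    · exact (mem_powersetCard_univ.1 (hX' (mem_product.1 (mem_filter.1 ‹_›).1).1)) ▸ ⟨c', rfl⟩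
    · obtain ⟨hUM, htight⟩ := mem_filter.1 hUM
      obtain ⟨hU, hM⟩ := mem_product.1 hUM
      obtain ⟨U', hU', hUU'⟩ := mem_image.1 hU
      have hU'' : (⟨UM.1, (mem_powersetCard_univ.1 (hX' hU)) ▸ ⟨c', rfl⟩⟩ : OddSet n) = U' := Subtype.ext hUU'.symm
      refine mem_filter.2 ⟨mem_product.2 ⟨by rw [hU'']; exact hU', hM⟩, ?_⟩
      simp only
      rw [cc_eq_card_filter_partner]
      exact htight
    · simp only [Prod.mk.injEq, Subtype.mk.injEq] at hh
      exact Prod.ext hh.1 hh.2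
    · obtain ⟨hUM, htight⟩ := mem_filter.1 hUM
      obtain ⟨hU, hM⟩ := mem_product.1 hUM
      refine ⟨(UM.1.1, UM.2), mem_filter.2 ⟨mem_product.2 ⟨mem_image_of_mem _ hU, hM⟩, ?_⟩, ?_⟩
      · simp only
        rw [← cc_eq_card_filter_partner]
        exact htight
      · simp
  · -- pass to complements: `|V ∖ U| = n − t = 2c''+1` with `2(n−t) ≤ n ≤ 5(n−t)`
    obtain ⟨m, hm⟩ := hn
    obtain ⟨c'', hc''⟩ : ∃ c'' : ℕ, n - (2 * c' + 1) = 2 * c'' + 1 := ⟨(n - (2 * c' + 1)) / 2, by omega⟩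
    have h2t' : 2 * (2 * c'' + 1) ≤ n := by omega
    have h5'' : n ≤ 5 * (2 * c'' + 1) := by rw [← hc'']; exact h5'
    set X' : Finset (Finset (Fin n)) := X.image (fun U => univ \ U.1) with hX'def
    have hX' : X' ⊆ univ.powersetCard (2 * c'' + 1) := by
      intro V hV
      obtain ⟨U, hU, rfl⟩ := mem_image.1 hV
      rw [mem_powersetCard_univ, card_univ_sdiff, Fintype.card_fin, hXt U hU, hc'']
    have hinj : Set.InjOn (fun U : OddSet n => univ \ U.1) ↑X := by
      intro U _ V _ hUV
      apply Subtype.ext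
      have := congrArg (fun W : Finset (Fin n) => univ \ W) hUV
      simpa [Finset.sdiff_sdiff_eq_self (subset_univ _)] using this
    have hcard : (X'.card : ℝ) = X.card := by rw [hX'def, card_image_of_injOn hinj]
    have hchoose : (n.choose (2 * c'' + 1) : ℝ) = n.choose (2 * c' + 1) := by
      rw [← hc'', Nat.choose_symm htn]
    have hmain := h n c'' hn₁ ⟨m, hm⟩ h2t' h5'' X' hX' Y hhom (by rw [hcard, hchoose]; exact hμ) hν
    -- `|Q_1(n − t)| = |Q_1(t)|` and its closed form at `c''`
    have hQ'' : ((Qset n (2 * c'' + 1) 1).card : ℝ) =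
        (Fintype.card (PMatch n) : ℝ) * ((((n / 2).choose (1 + c'') * (1 + c'').choose c'' * 2 ^ 1 : ℕ) : ℝ)) := by
      have h0 := card_Qset_eq (n := n) (c' := c'') (m := 0) (Nat.zero_le _)
      simp only [Nat.mul_zero, Nat.zero_add, Nat.sub_zero] at h0
      rw [h0]
    have hQsym : ((Qset n (2 * c'' + 1) 1).card : ℝ) = (Qset n (2 * c' + 1) 1).card := by
      rw [← hc'']
      exact_mod_cast card_Qset_compl ⟨m, hm⟩ htn
    rw [hcard, hchoose, ← hQ'', hQsym] at hmain
    refine hmain.trans (le_of_eq ?_)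
    norm_cast
    -- the tight pairs of `X' × Y` in partner currency are the tight pairs of `X × Y` in `cc` currency, via complements
    refine card_bij (fun VM hVM => (⟨univ \ VM.1, ?_⟩, VM.2)) (fun VM hVM => ?_) (fun VM hVM VM' hVM' hh => ?_) (fun UM hUM => ?_)
    · have hV := (mem_product.1 (mem_filter.1 hVM).1).1
      rw [card_univ_sdiff, Fintype.card_fin, (mem_powersetCard_univ.1 (hX' hV)), ← hc'']
      refine ⟨c', by omega⟩
    · obtain ⟨hVM', htight⟩ := mem_filter.1 hVM
      obtain ⟨hV, hM⟩ := mem_product.1 hVM'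
      obtain ⟨U, hU, hUV⟩ := mem_image.1 hV
      have hUeq : (⟨univ \ VM.1, by
          rw [card_univ_sdiff, Fintype.card_fin, (mem_powersetCard_univ.1 (hX' hV)), ← hc'']; exact ⟨c', by omega⟩⟩ : OddSet n) = U := by
        apply Subtype.ext
        simp only [← hUV, Finset.sdiff_sdiff_eq_self (subset_univ _)]
      refine mem_filter.2 ⟨mem_product.2 ⟨by rw [hUeq]; exact hU, hM⟩, ?_⟩
      simp only
      rw [hUeq]
      have hodd : Odd (univ \ U.1).card := by
        rw [card_univ_sdiff, Fintype.card_fin, hXt U hU, hc'']; exact ⟨c'', rfl⟩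
      rw [← cc_compl U hodd VM.2, cc_eq_card_filter_partner]
      simpa only [← hUV] using htight
    · simp only [Prod.mk.injEq, Subtype.mk.injEq] at hh
      obtain ⟨h1, h2⟩ := hh
      have : VM.1 = VM'.1 := by
        simpa [Finset.sdiff_sdiff_eq_self (subset_univ _)] using congrArg (fun W : Finset (Fin n) => univ \ W) h1
      exact Prod.ext this h2
    · obtain ⟨hUM', htight⟩ := mem_filter.1 hUM
      obtain ⟨hU, hM⟩ := mem_product.1 hUM'
      have hodd : Odd (univ \ UM.1.1).card := by
        rw [card_univ_sdiff, Fintype.card_fin, hXt UM.1 hU, hc'']; exact ⟨c'', rfl⟩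
      refine ⟨(univ \ UM.1.1, UM.2), mem_filter.2 ⟨mem_product.2 ⟨mem_image_of_mem _ hU, hM⟩, ?_⟩, ?_⟩
      · simp only
        rw [← cc_eq_card_filter_partner ⟨univ \ UM.1.1, hodd⟩ UM.2, cc_compl UM.1 hodd UM.2]
        exact htight
      · simp only [Finset.sdiff_sdiff_eq_self (subset_univ _)]

end Summit.PneNP.PneNP.Theorems.ChebyshevTracialDesignTightMass
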